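import Mathlib.Analysis.Calculus.MeanValue
import Summits.QuantumFields.YangMills.Theorems.BalabanUVNodesN21DilationRadialInputs
import Summits.QuantumFields.YangMills.Theorems.BalabanUVNodesN21ProjectedCentreDilation

/-!
# N21 (NE7c) · RADIAL TRANSVERSALITY OF A RESPONSE MAP WITH A QUADRATIC-REMAINDER LINEARISATION — part 34's `hRT`
# binder DISCHARGED for cube sups of plaquette readings of such a response (W-SEAT START-LIST v3 §n21 item 3; lens
# near-miss v31.0 N213 (α) / ROW S¹⁰, first rung)

Width seat `pub-ymgap-dag-n21-w3` (g0), node N21 = NE7c (single-run shell-weight bound `T4IndicatorShell.ShellWeightBound`,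
NOT PRINTED in [Bałaban 1983–89], NOT proved), lane K3⁷ `SpineGivenEndpointR13SepCoPH` (stmt-QuantumFields-20544,
`--kind proof --supports … --as helper`).  Consumes BY NAME part 20 `…N21DilationRadialInputs`
(`affine_radialTransversal_perturbed`, `radialTransversal_iSup` — dag-n21-d g8 / lens g24) and part 34
`…N21ProjectedCentreDilation` (`slotAntiConcentration_restrict_of_projectedCentre` — dag-n21-d g8 / lens g29); nothing
of theirs is retyped.

WHY.  On the projected-centre road (parts 27–34) every binder of the re-centred END is discharged or is a located
letter EXCEPT the radial transversality `hRT` of the actually tested variable `U` (lens N213 (α): «the one item no road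
has typed beyond a hypothesis»): `U p + κ₀θ(1−ρ)(s−1) ≤ U (p.1, c p.1 + s•(p.2 − c p.1))` for `s ≥ 1` between points of
the shell ∩ cut.  Part 20 types it for AFFINE letters `‖c + f z‖` (the response linearised at the background, `κa = a −
‖c‖`) and for a perturbation `G` with a radial-Lipschitz HYPOTHESIS `‖G(s•z) − G z‖ ≤ γ(s−1)`.  THIS FILE supplies that
hypothesis from the first honest property of the nonlinear response beyond linearity — a LINEARISATION WITH QUADRATIC
REMAINDER at every point of the kept cut (the Hessian-at-the-point rung):
`‖Φ w′ − Φ w − L_w (w′ − w)‖ ≤ M‖w′ − w‖²` for `w, w′ ∈ K` — and delivers part 34's `hRT` VERBATIM for the tested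
variable `U p = ⨆ q, ‖Φ q p.1 p.2‖` (cube sup over a finite plaquette family `q` of the readings of the response map
`Φ q z : V → E`, block variables ↦ plaquette field of the minimiser, exterior configuration `z`), with ANY rate `κ₀`
such that `c₀ + 4MR² ≤ (1 − κ₀)θ(1−ρ)` (`c₀` = core reading at the centre, `R` = radius of the kept cut about the
centre).  `M = 0` is part 20's affine case.

WHAT IS PROVED ([textbook] normed-space algebra; 0 def, 0 sorry).
* §1 `linearisation_diff_le_of_quadraticResponse`: two linearisations of the same response differ, in the direction
  joining their base points, by `≤ 2M‖w′ − w‖²`;  `radialRemainder_le_of_quadraticResponse`: along the ray from a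
  centre `c ∈ K` the nonlinear remainder `G v = Φ(c+v) − Φ c − L_c v` is radially Lipschitz with `γ = 3MR²`;
  `quadraticResponse_of_lipschitz_hasFDerivWithin`: the HESSIAN RUNG — a derivative `D w` within the convex kept cut
  with `w ↦ D w` `Λ`-Lipschitz in operator norm supplies the quadratic remainder with `M = Λ` (Mathlib's mean value
  inequality on segments).
* §2 `radialTransversal_of_quadraticResponse` (one letter): `‖Φ w‖ + (s−1)(‖Φ w‖ − (c₀ + 4MR²)) ≤ ‖Φ(c + s•(w−c))‖`
  (`s ≥ 1`, `w` and the dilate in `K`) — part 20's `affine_radialTransversal_perturbed` with its `hG` DISCHARGED;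
  `radialTransversal_iSup_of_quadraticResponse`: the cube sup (part 20 `radialTransversal_iSup`).
* §3 ★ `hRT_of_quadraticResponse`: part 34's binder `hRT` in its exact shape, in the product frame `X × V`, for
  `U p = ⨆ q, ‖Φ q p.1 p.2‖`, any cut `C ⊆ {p | p.2 ∈ K p.1}` (the shape of 38l/38n's `C := C⋆ ∩ ⋂ᵢ{q.2 i ∈ P₁ i}`).
* §4 ★★ `slotAntiConcentration_restrict_of_projectedCentre_quadraticResponse`: part 34's (M1) on the cut law about the
  A-projected centre with `hRT` REPLACED by the response letters `(Φ, L, M, R, c₀)` + the numeral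
  `c₀ + 4MR² ≤ (1 − κ₀)θ(1−ρ)`; the remaining displayed binders (`hobt`, `hfar`, `henv`, `hQ`, coercivity `γ`, Lipschitz
  `G`) are part 34's own, untouched.
* §5 A2/A6: `quadraticResponse_letters_inhabited` — the response letters AND the numeral are jointly inhabited by a
  genuinely NONLINEAR response (`Φ w = w + w²∕4` on `K = [−1, 1]`, `L_w = (1 + w∕2)·id`, `M = ¼`, `R = 1`, `c₀ = 0`,
  `θ = 4`, `ρ = κ₀ = ½`), and `hRT_of_quadraticResponse_apply_witness` applies §3 to it (frame `X = Unit`,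
  `V = E = ℝ`, one plaquette) — a TYPE-CHECK ONLY: on that cut the statistic `|w + w²∕4| ≤ 5∕4 < 2 = θ(1−ρ)`, so the
  shell is EMPTY and that implication is vacuous (referee ref-O READ-1 NIT-2 on p583660; v1.1 correction of the
  wording).  The NON-VACUOUS witnesses live in the companion file `…N21ResponseRadialTransversalitySanity` (this seat):
  `hRT_of_quadraticResponse_apply_witness_slope3` ∕ `apply_witness_slope3_antecedent_inhabited` (the re-witness
  `Φ w = 3w + w²∕4`, same `M ∕ R ∕ c₀` ∕ numeral, whose shell `{2 ≤ U < 4} ∩ C` contains `w = 4∕5`, every antecedent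
  clause of §3 satisfied at `s = 1`) and `responseJunction_binders_inhabited` (the JOINT binder system of §4 — part
  34's binders together with the response letters — discharged at once on explicit objects with a non-empty shell).
  In THIS file the joint system is not exhibited (A2) — §4 is a LOCATED junction.

DICTIONARY (lens N212/N213, NOT asserted): `Φ q z w` ↔ `U_k(V(z,w))(∂q) − 1`, the plaquette-`q` reading of Bałaban's
background (minimiser) as a function of ONE block's integration variables `w` at exterior configuration `z`
([B14] (2.17)/(2.21)); `L q z w` ↔ its linear response (the Green's-function formula of the constrained variational
problem, [B11] = CMP 102 (1985) 277, (190); [LF-I] = CMP 122 (1989) 175, p. 185); `M` ↔ the curvature of the response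
on the kept cut (from the analyticity of Theorem 1 of [B11] with a Cauchy estimate — the NEXT RUNG, to be read at NODE
00's `UbgOfRecord` / the B12 carriers' `analyticOn` clause; not in this file); `c₀` ↔ the core reading at the centre
(part 29 `core_reading_le_of_kernelDecay`); `R` ↔ the block letter radius; `κ₀` ↔ part 34's rate.  The numeral
`c₀ + 4MR² ≤ (1 − κ₀)θ(1−ρ)` is the located condition this rung isolates: CURVATURE × (BLOCK RADIUS)² against the
threshold — a statement about Bałaban's variational problem, NOT about measures, NOT PRINTED as such.  SIZES (located,
NOT asserted, for the next rung's reader): a Cauchy estimate on an analyticity domain of radius `r` in the block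
variables on which the readings are bounded by `B` gives `M ≲ B∕r²`, so `4MR² ≲ 4B(R∕r)²`; read at [B11] Theorem 1's
letters (`r ↔ a₁`, `B ↔ B₃a₁η²`, kept-cut radius `R ↔` the block's small-field letter `ε ≤ a₁`) this is
`≲ 4(B₃ε∕a₁)·εη²`, i.e. SMALL against a threshold `θ ≍ εη²` exactly in print's standing regime `B₃ε ≪ a₁` — the rung's
numeral is print-compatible in shape; certifying it at the record's letters is not attempted here.

HONEST FRAMING.  [textbook]; located letters (`M, R, c₀, κ₀`; part 34's `γ, G`, obtuseness, farness, envelope, odds)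
NOT asserted; nothing of Bałaban's asserted; NE7c NOT PRINTED ∕ NOT proved; N21 NOT discharged; counts unmoved (typed
28∕28 · discharged 5∕27); count-neutral; one finite 𝕋⁴ at fixed ε — YM mass gap (Clay) is NOT proved by any of this:
R4 closes the conditional finite-𝕋⁴ rung `BalabanLadder.UV` only; nothing continuum ∕ ℝ⁴ ∕ OS ∕ mass gap ∕ Clay.
-/

open MeasureTheory Set Function Matrix
open scoped ENNReal

namespace Summit.QuantumFields.YangMills.Theorems.N21ResponseRadialTransversality

open Literature.MathematicalPhysics.QuantumFieldTheory.Balaban1983to89.T4ShellMeasure (SlotAntiConcentration)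
open Summit.QuantumFields.YangMills.Theorems.N21DilationRadialInputs
  (affine_radialTransversal_perturbed radialTransversal_iSup)
open Summit.QuantumFields.YangMills.Theorems.N21ProjectedCentreDilation
  (slotAntiConcentration_restrict_of_projectedCentre)

/-! ## §1  Two linearisations in the joining direction; the radial remainder -/

section OneLetter

variable {V E : Type*} [NormedAddCommGroup V] [NormedSpace ℝ V] [NormedAddCommGroup E] [NormedSpace ℝ E]

/-- **TWO LINEARISATIONS OF A QUADRATIC-REMAINDER RESPONSE DIFFER BY `2M‖w′ − w‖²` IN THE JOINING DIRECTION.**  If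
`‖Φ w′ − Φ w − L_w(w′ − w)‖ ≤ M‖w′ − w‖²` for all `w, w′ ∈ K`, then `‖L_w(w′ − w) − L_{w′}(w′ − w)‖ ≤ 2M‖w′ − w‖²` (add the
two Taylor estimates `w → w′` and `w′ → w`).  No Lipschitz bound on `w ↦ L_w` as an operator is needed. [textbook] -/
theorem linearisation_diff_le_of_quadraticResponse (Φ : V → E) (L : V → V →ₗ[ℝ] E) {K : Set V} {M : ℝ}
    (hT : ∀ w ∈ K, ∀ w' ∈ K, ‖Φ w' - Φ w - L w (w' - w)‖ ≤ M * ‖w' - w‖ ^ 2)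
    {w w' : V} (hw : w ∈ K) (hw' : w' ∈ K) :
    ‖L w (w' - w) - L w' (w' - w)‖ ≤ 2 * M * ‖w' - w‖ ^ 2 := by
  have h1 := hT w hw w' hw'
  have h2 := hT w' hw' w hw
  have hneg : w - w' = -(w' - w) := (neg_sub w' w).symm
  rw [hneg, map_neg, norm_neg] at h2
  have hdec : L w (w' - w) - L w' (w' - w)
      = -(Φ w' - Φ w - L w (w' - w)) - (Φ w - Φ w' - -(L w' (w' - w))) := by abel
  rw [hdec]
  calc ‖-(Φ w' - Φ w - L w (w' - w)) - (Φ w - Φ w' - -(L w' (w' - w)))‖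
      ≤ ‖-(Φ w' - Φ w - L w (w' - w))‖ + ‖Φ w - Φ w' - -(L w' (w' - w))‖ := norm_sub_le _ _
    _ ≤ M * ‖w' - w‖ ^ 2 + M * ‖w' - w‖ ^ 2 := by rw [norm_neg]; exact add_le_add h1 h2
    _ = 2 * M * ‖w' - w‖ ^ 2 := by ring

/-- **THE RADIAL REMAINDER ABOUT A CENTRE IS RADIALLY LIPSCHITZ WITH `γ = 3MR²`.**  For a centre `c ∈ K`, a point
`w ∈ K` with `z = w − c`, `s ≥ 1` with the dilate `c + s•z ∈ K`, and the kept cut inside the letter ball `‖· − c‖ ≤ R`: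
the remainder `G v = Φ(c + v) − Φ c − L_c v` satisfies `‖G(s•z) − G z‖ ≤ 3MR²·(s − 1)` — part 20's hypothesis `hG`.
(`G(s•z) − G z = [Φ(c+s•z) − Φ w − L_w((s−1)•z)] + (s−1)•[L_w z − L_c z]`; the first is `≤ M(s−1)²‖z‖²`, the second
`≤ (s−1)·2M‖z‖²` by §1; `‖z‖ ≤ R`, `(s−1)‖z‖ ≤ s‖z‖ ≤ R`.) [textbook] -/
theorem radialRemainder_le_of_quadraticResponse (Φ : V → E) (L : V → V →ₗ[ℝ] E) {K : Set V} {M R : ℝ} (hM : 0 ≤ M)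
    (hT : ∀ w ∈ K, ∀ w' ∈ K, ‖Φ w' - Φ w - L w (w' - w)‖ ≤ M * ‖w' - w‖ ^ 2)
    {c : V} (hc : c ∈ K) (hKR : ∀ w ∈ K, ‖w - c‖ ≤ R)
    {w : V} (hw : w ∈ K) {s : ℝ} (hs : 1 ≤ s) (hws : c + s • (w - c) ∈ K) :
    ‖(Φ (c + s • (w - c)) - Φ c - L c (s • (w - c))) - (Φ (c + (w - c)) - Φ c - L c (w - c))‖
      ≤ 3 * M * R ^ 2 * (s - 1) := by
  set z : V := w - c with hz
  have hcw : c + z = w := by rw [hz]; abel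
  have hzR : ‖z‖ ≤ R := hKR w hw
  have hR0 : 0 ≤ R := (norm_nonneg _).trans hzR
  have hs0 : 0 ≤ s - 1 := by linarith
  have hszR : s * ‖z‖ ≤ R := by
    have h := hKR _ hws
    rwa [add_sub_cancel_left, norm_smul, Real.norm_of_nonneg (by linarith)] at h
  have hs1zR : (s - 1) * ‖z‖ ≤ R := by nlinarith [norm_nonneg z]
  -- the Taylor estimate w → c + s•z : the increment is (s-1)•z
  have hincr : c + s • z - w = (s - 1) • z := by
    rw [← hcw, sub_smul, one_smul]; abel
  have hA : ‖Φ (c + s • z) - Φ w - L w ((s - 1) • z)‖ ≤ M * ((s - 1) * ‖z‖) ^ 2 := by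
    have h := hT w hw (c + s • z) hws
    rw [hincr, norm_smul, Real.norm_of_nonneg hs0] at h
    exact h
  -- the two linearisations at c and at w in the direction z
  have hB : ‖L c z - L w z‖ ≤ 2 * M * ‖z‖ ^ 2 := by
    have h := linearisation_diff_le_of_quadraticResponse Φ L hT hc hw
    rw [show w - c = z from rfl] at h
    exact h
  -- decomposition
  have hdec : (Φ (c + s • z) - Φ c - L c (s • z)) - (Φ (c + z) - Φ c - L c z)
      = (Φ (c + s • z) - Φ w - L w ((s - 1) • z)) - (s - 1) • (L c z - L w z) := by
    rw [hcw]
    simp only [map_smul, map_sub, smul_sub, sub_smul, one_smul]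
    abel
  rw [hdec]
  calc ‖(Φ (c + s • z) - Φ w - L w ((s - 1) • z)) - (s - 1) • (L c z - L w z)‖
      ≤ ‖Φ (c + s • z) - Φ w - L w ((s - 1) • z)‖ + ‖(s - 1) • (L c z - L w z)‖ := norm_sub_le _ _
    _ ≤ M * ((s - 1) * ‖z‖) ^ 2 + (s - 1) * (2 * M * ‖z‖ ^ 2) := by
        rw [norm_smul, Real.norm_of_nonneg hs0]
        exact add_le_add hA (mul_le_mul_of_nonneg_left hB hs0)
    _ ≤ 3 * M * R ^ 2 * (s - 1) := by
        -- (s-1)²‖z‖² ≤ (s-1)·R·R and ‖z‖² ≤ R²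
        have h1 : ((s - 1) * ‖z‖) ^ 2 ≤ (s - 1) * R ^ 2 := by
          have : ((s - 1) * ‖z‖) ^ 2 = (s - 1) * (((s - 1) * ‖z‖) * ‖z‖) := by ring
          rw [this]
          exact mul_le_mul_of_nonneg_left (by nlinarith [norm_nonneg z]) hs0
        have h2 : ‖z‖ ^ 2 ≤ R ^ 2 := pow_le_pow_left₀ (norm_nonneg z) hzR 2
        nlinarith [mul_le_mul_of_nonneg_left h1 hM, mul_le_mul_of_nonneg_left h2 hM]

/-- **THE HESSIAN RUNG SUPPLIES THE QUADRATIC REMAINDER** (mean value inequality, Mathlib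
`Convex.norm_image_sub_le_of_norm_hasFDerivWithin_le'` on the segment): if `Φ` has derivative `D w` within the convex
kept cut `K` at every `w ∈ K` and `w ↦ D w` is `Λ`-Lipschitz on `K` in operator norm (a bound `Λ` on the second
derivative), then the linearisations `L_w = D w` have quadratic remainder `≤ Λ‖w′ − w‖²` — the hypothesis `hT` of
§2–§4 with `M = Λ`. [textbook] -/
theorem quadraticResponse_of_lipschitz_hasFDerivWithin (Φ : V → E) (D : V → V →L[ℝ] E) {K : Set V} {Λ : ℝ}
    (hΛ : 0 ≤ Λ) (hK : Convex ℝ K) (hD : ∀ w ∈ K, HasFDerivWithinAt Φ (D w) K w)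
    (hLip : ∀ w ∈ K, ∀ w' ∈ K, ‖D w' - D w‖ ≤ Λ * ‖w' - w‖) :
    ∀ w ∈ K, ∀ w' ∈ K, ‖Φ w' - Φ w - ((D w : V →L[ℝ] E) : V →ₗ[ℝ] E) (w' - w)‖ ≤ Λ * ‖w' - w‖ ^ 2 := by
  intro w hw w' hw'
  have hS : segment ℝ w w' ⊆ K := hK.segment_subset hw hw'
  have hf : ∀ x ∈ segment ℝ w w', HasFDerivWithinAt Φ (D x) (segment ℝ w w') x :=
    fun x hx => (hD x (hS hx)).mono hS
  have hbound : ∀ x ∈ segment ℝ w w', ‖D x - D w‖ ≤ Λ * ‖w' - w‖ := fun x hx =>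
    (hLip w hw x (hS hx)).trans (mul_le_mul_of_nonneg_left (norm_sub_le_of_mem_segment hx) hΛ)
  have h := (convex_segment w w').norm_image_sub_le_of_norm_hasFDerivWithin_le' hf hbound
    (left_mem_segment ℝ w w') (right_mem_segment ℝ w w')
  rw [ContinuousLinearMap.coe_coe, pow_two, ← mul_assoc]
  exact h

/-! ## §2  Radial transversality of one letter and of a cube sup -/

/-- **RADIAL TRANSVERSALITY OF A QUADRATIC-REMAINDER RESPONSE LETTER** (part 20's `affine_radialTransversal_perturbed`
with its radial-Lipschitz hypothesis DISCHARGED by §1): for `c, w ∈ K`, `s ≥ 1`, the dilate `c + s•(w − c) ∈ K`, the kept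
cut inside `‖· − c‖ ≤ R` and the core reading `‖Φ c‖ ≤ c₀`:
`‖Φ w‖ + (s − 1)(‖Φ w‖ − (c₀ + 4MR²)) ≤ ‖Φ(c + s•(w − c))‖`. [textbook] -/
theorem radialTransversal_of_quadraticResponse (Φ : V → E) (L : V → V →ₗ[ℝ] E) {K : Set V} {M R c₀ : ℝ}
    (hM : 0 ≤ M) (hT : ∀ w ∈ K, ∀ w' ∈ K, ‖Φ w' - Φ w - L w (w' - w)‖ ≤ M * ‖w' - w‖ ^ 2)
    {c : V} (hc : c ∈ K) (hKR : ∀ w ∈ K, ‖w - c‖ ≤ R) (hc₀ : ‖Φ c‖ ≤ c₀)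
    {w : V} (hw : w ∈ K) {s : ℝ} (hs : 1 ≤ s) (hws : c + s • (w - c) ∈ K) :
    ‖Φ w‖ + (s - 1) * (‖Φ w‖ - (c₀ + 4 * M * R ^ 2)) ≤ ‖Φ (c + s • (w - c))‖ := by
  set z : V := w - c with hz
  set G : V → E := fun v => Φ (c + v) - Φ c - L c v with hG
  have hcw : c + z = w := by rw [hz]; abel
  have hzR : ‖z‖ ≤ R := hKR w hw
  have hs0 : 0 ≤ s - 1 := by linarith
  -- part 20's hypothesis, discharged
  have hGrad : ‖G (s • z) - G z‖ ≤ 3 * M * R ^ 2 * (s - 1) :=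
    radialRemainder_le_of_quadraticResponse Φ L hM hT hc hKR hw hs hws
  have h20 := affine_radialTransversal_perturbed (Φ c) (L c) G z hs hGrad
  -- rewrite the three composites
  have hw' : Φ c + L c z + G z = Φ w := by rw [hG]; simp only; rw [hcw]; abel
  have hsw : Φ c + L c (s • z) + G (s • z) = Φ (c + s • z) := by rw [hG]; simp only; abel
  rw [hw', hsw] at h20
  -- ‖G z‖ ≤ M‖z‖² ≤ MR²
  have hGz : ‖G z‖ ≤ M * R ^ 2 := by
    have h := hT c hc w hw
    have : G z = Φ w - Φ c - L c (w - c) := by rw [hG]; simp only; rw [hcw]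
    rw [this]
    exact h.trans (mul_le_mul_of_nonneg_left (pow_le_pow_left₀ (norm_nonneg _) hzR 2) hM)
  have hmono : (s - 1) * (‖Φ w‖ - (c₀ + 4 * M * R ^ 2))
      ≤ (s - 1) * (‖Φ w‖ - ‖Φ c‖ - ‖G z‖ - 3 * M * R ^ 2) :=
    mul_le_mul_of_nonneg_left (by linarith) hs0
  linarith

/-- **A CUBE SUP OF QUADRATIC-REMAINDER RESPONSE LETTERS IS RADIALLY TRANSVERSAL** (finite plaquette family `q`,
common letters `M, R, c₀`; part 20 `radialTransversal_iSup`). [textbook] -/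
theorem radialTransversal_iSup_of_quadraticResponse {P : Type*} [Fintype P] [Nonempty P]
    (Φ : P → V → E) (L : P → V → V →ₗ[ℝ] E) {K : Set V} {M R c₀ : ℝ}
    (hM : 0 ≤ M) (hT : ∀ q, ∀ w ∈ K, ∀ w' ∈ K, ‖Φ q w' - Φ q w - L q w (w' - w)‖ ≤ M * ‖w' - w‖ ^ 2)
    {c : V} (hc : c ∈ K) (hKR : ∀ w ∈ K, ‖w - c‖ ≤ R) (hc₀ : ∀ q, ‖Φ q c‖ ≤ c₀)
    {w : V} (hw : w ∈ K) {s : ℝ} (hs : 1 ≤ s) (hws : c + s • (w - c) ∈ K) :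
    (⨆ q, ‖Φ q w‖) + (s - 1) * ((⨆ q, ‖Φ q w‖) - (c₀ + 4 * M * R ^ 2)) ≤ ⨆ q, ‖Φ q (c + s • (w - c))‖ :=
  radialTransversal_iSup (fun q v => ‖Φ q v‖) w (c + s • (w - c))
    fun q => radialTransversal_of_quadraticResponse (Φ q) (L q) hM (hT q) hc hKR (hc₀ q) hw hs hws

end OneLetter

/-! ## §3  Part 34's binder `hRT`, verbatim, for the cube sup of a quadratic-remainder response -/

section Frame

variable {X V E : Type*} [NormedAddCommGroup V] [NormedSpace ℝ V] [NormedAddCommGroup E] [NormedSpace ℝ E]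
  {P : Type*} [Fintype P] [Nonempty P]

/-- ★ **PART 34's RADIAL-TRANSVERSALITY BINDER `hRT`, DISCHARGED** for the tested variable
`U p = ⨆ q, ‖Φ q p.1 p.2‖` in the product frame `X × V` (exterior configuration `p.1`, block variables `p.2`): if every
plaquette response `Φ q z` admits a quadratic-remainder linearisation on the kept cut `K z` (letter `M`), the kept cut
lies in the letter ball of radius `R` about the centre `c z ∈ K z`, the core readings are `≤ c₀`, the cut `C` keeps
`p.2 ∈ K p.1`, and the NUMERAL `c₀ + 4MR² ≤ (1 − κ₀)θ(1−ρ)` holds, then for every shell ∩ `C` point `p` and every `s ≥ 1`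
with the dilate in `C`: `U p + κ₀θ(1−ρ)(s−1) ≤ U(p.1, c p.1 + s•(p.2 − c p.1))` — the binder's exact shape (the two
shell conditions on the dilate are not even used). [textbook] -/
theorem hRT_of_quadraticResponse (Φ : P → X → V → E) (L : P → X → V → V →ₗ[ℝ] E) (K : X → Set V) (c : X → V)
    {M R c₀ θ ρ κ₀ : ℝ} (hM : 0 ≤ M)
    (hT : ∀ q z, ∀ w ∈ K z, ∀ w' ∈ K z, ‖Φ q z w' - Φ q z w - L q z w (w' - w)‖ ≤ M * ‖w' - w‖ ^ 2)
    (hcK : ∀ z, c z ∈ K z) (hKR : ∀ z, ∀ w ∈ K z, ‖w - c z‖ ≤ R) (hc₀ : ∀ q z, ‖Φ q z (c z)‖ ≤ c₀)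
    {C : Set (X × V)} (hCK : ∀ p ∈ C, p.2 ∈ K p.1)
    (hnum : c₀ + 4 * M * R ^ 2 ≤ (1 - κ₀) * (θ * (1 - ρ))) :
    ∀ p : X × V, θ * (1 - ρ) ≤ (⨆ q, ‖Φ q p.1 p.2‖) → (⨆ q, ‖Φ q p.1 p.2‖) < θ → p ∈ C → ∀ s : ℝ, 1 ≤ s →
      θ * (1 - ρ) ≤ (⨆ q, ‖Φ q p.1 (c p.1 + s • (p.2 - c p.1))‖) →
        (⨆ q, ‖Φ q p.1 (c p.1 + s • (p.2 - c p.1))‖) < θ → (p.1, c p.1 + s • (p.2 - c p.1)) ∈ C →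
          (⨆ q, ‖Φ q p.1 p.2‖) + κ₀ * (θ * (1 - ρ)) * (s - 1) ≤ ⨆ q, ‖Φ q p.1 (c p.1 + s • (p.2 - c p.1))‖ := by
  intro p hlo _ hpC s hs _ _ hsC
  have hw : p.2 ∈ K p.1 := hCK p hpC
  have hws : c p.1 + s • (p.2 - c p.1) ∈ K p.1 := hCK _ hsC
  have h2 := radialTransversal_iSup_of_quadraticResponse (fun q => Φ q p.1) (fun q => L q p.1) hM
    (fun q => hT q p.1) (hcK p.1) (hKR p.1) (fun q => hc₀ q p.1) hw hs hws
  have hs0 : 0 ≤ s - 1 := by linarith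
  have hstep : (s - 1) * (κ₀ * (θ * (1 - ρ)))
      ≤ (s - 1) * ((⨆ q, ‖Φ q p.1 p.2‖) - (c₀ + 4 * M * R ^ 2)) :=
    mul_le_mul_of_nonneg_left (by linarith) hs0
  linarith

end Frame

/-! ## §4  Part 34's (M1) about the A-projected centre with `hRT` REPLACED by the response letters -/

section Junction

variable {X : Type*} [MeasurableSpace X] {κ : Type*} [Fintype κ]
  {E : Type*} [NormedAddCommGroup E] [NormedSpace ℝ E] {P : Type*} [Fintype P] [Nonempty P]

/-- ★★ **(M1) ON THE CUT LAW ABOUT THE A-PROJECTED CENTRE FOR A QUADRATIC-REMAINDER RESPONSE** (part 34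
`slotAntiConcentration_restrict_of_projectedCentre` with its binder `hRT` DISCHARGED by §3): the tested variable is the
cube sup `U p = ⨆ q, ‖Φ q p.1 p.2‖` of the plaquette readings of a response with quadratic-remainder linearisations on
the kept convex cut `K z ⊆ {‖· − c z‖ ≤ R}` (letters `M, R`, core reading `c₀`), the cut `C` keeps `p.2 ∈ K p.1`, and
`c₀ + 4MR² ≤ (1 − κ₀)θ(1−ρ)` with `0 < κ₀`; all other binders are part 34's, displayed unchanged:
`SlotAntiConcentration (ν|({U<θ} ∩ C)) U θ ρ (3(#κ+1)(1+Q)∕(κ₀(1−ρ)))`.  LOCATED junction (A2: the joint system is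
not exhibited here). [textbook] -/
theorem slotAntiConcentration_restrict_of_projectedCentre_quadraticResponse [Nonempty κ] (ζ : Measure X) [SFinite ζ]
    (K : X → Set (κ → ℝ)) (A : Matrix κ κ ℝ) (hA : A.IsSymm) {γ G : ℝ} (hγ0 : 0 < γ)
    (hγ : ∀ x : κ → ℝ, γ * ‖x‖ ^ 2 ≤ x ⬝ᵥ (A *ᵥ x))
    (m : X → (κ → ℝ)) {c : X → (κ → ℝ)} (hc : Measurable c) (Pz : X → (κ → ℝ) → ℝ)
    (hg : Measurable fun p : X × (κ → ℝ) => (K p.1).indicator (fun w => ENNReal.ofReal (Real.exp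
      (-(1 / 2 * ((w - m p.1) ⬝ᵥ (A *ᵥ (w - m p.1))) + Pz p.1 w)))) p.2)
    (Φ : P → X → (κ → ℝ) → E) (L : P → X → (κ → ℝ) → (κ → ℝ) →ₗ[ℝ] E) {M R c₀ : ℝ} (hM : 0 ≤ M)
    (hT : ∀ q z, ∀ w ∈ K z, ∀ w' ∈ K z, ‖Φ q z w' - Φ q z w - L q z w (w' - w)‖ ≤ M * ‖w' - w‖ ^ 2)
    (hKR : ∀ z, ∀ w ∈ K z, ‖w - c z‖ ≤ R) (hc₀ : ∀ q z, ‖Φ q z (c z)‖ ≤ c₀)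
    (hUm : Measurable fun p : X × (κ → ℝ) => ⨆ q, ‖Φ q p.1 p.2‖)
    {C Env : Set (X × (κ → ℝ))} (hC : MeasurableSet C) (hEnv : MeasurableSet Env)
    (hCK : ∀ p ∈ C, p.2 ∈ K p.1)
    {θ ρ κ₀ Q : ℝ} (hθ : 0 < θ) (hρ0 : 0 < ρ) (hρ1 : ρ < 1) (hκ : 0 < κ₀) (hQ0 : 0 ≤ Q)
    (hnum : c₀ + 4 * M * R ^ 2 ≤ (1 - κ₀) * (θ * (1 - ρ)))
    (hK : ∀ z, Convex ℝ (K z)) (hcK : ∀ z, c z ∈ K z)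
    (hP : ∀ z, ∀ v ∈ K z, ∀ v' ∈ K z, Pz z v - Pz z v' ≤ G * ‖v - v'‖)
    (hobt : ∀ p : X × (κ → ℝ), θ * (1 - ρ) ≤ (⨆ q, ‖Φ q p.1 p.2‖) → (⨆ q, ‖Φ q p.1 p.2‖) < θ → p ∈ C →
      p.2 ∈ K p.1 → 0 ≤ (c p.1 - m p.1) ⬝ᵥ (A *ᵥ (p.2 - c p.1)))
    (hfar : ∀ p : X × (κ → ℝ), θ * (1 - ρ) ≤ (⨆ q, ‖Φ q p.1 p.2‖) → (⨆ q, ‖Φ q p.1 p.2‖) < θ → p ∈ C →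
      p.2 ∈ K p.1 → 2 * G ≤ γ * ‖p.2 - c p.1‖)
    (henv : ∀ l ∈ Icc (1 - 1 / ((Fintype.card κ : ℝ) + 1)) 1, ∀ p : X × (κ → ℝ),
      θ * (1 - ρ) ≤ (⨆ q, ‖Φ q p.1 p.2‖) → (⨆ q, ‖Φ q p.1 p.2‖) < θ → p ∈ C →
        (p.1, c p.1 + l • (p.2 - c p.1)) ∈ Env)
    (hQ : ((ζ.prod volume).withDensity fun p : X × (κ → ℝ) => (K p.1).indicator (fun w => ENNReal.ofReal (Real.exp
        (-(1 / 2 * ((w - m p.1) ⬝ᵥ (A *ᵥ (w - m p.1))) + Pz p.1 w)))) p.2)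
        (Env \ ({p | (⨆ q, ‖Φ q p.1 p.2‖) < θ} ∩ C))
      ≤ ENNReal.ofReal Q * ((ζ.prod volume).withDensity fun p : X × (κ → ℝ) => (K p.1).indicator (fun w =>
        ENNReal.ofReal (Real.exp (-(1 / 2 * ((w - m p.1) ⬝ᵥ (A *ᵥ (w - m p.1))) + Pz p.1 w)))) p.2)
        ({p | (⨆ q, ‖Φ q p.1 p.2‖) < θ} ∩ C)) :
    SlotAntiConcentration
      ((((ζ.prod volume).withDensity fun p : X × (κ → ℝ) => (K p.1).indicator (fun w => ENNReal.ofReal (Real.exp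
          (-(1 / 2 * ((w - m p.1) ⬝ᵥ (A *ᵥ (w - m p.1))) + Pz p.1 w)))) p.2)).restrict
        ({p | (⨆ q, ‖Φ q p.1 p.2‖) < θ} ∩ C))
      (fun p : X × (κ → ℝ) => ⨆ q, ‖Φ q p.1 p.2‖) θ ρ
      (3 * ((Fintype.card κ : ℝ) + 1) * (1 + Q) / (κ₀ * (1 - ρ))) :=
  slotAntiConcentration_restrict_of_projectedCentre ζ K A hA hγ0 hγ m hc Pz hg hUm hC hEnv hθ hρ0 hρ1 hκ hQ0
    hK hcK hP hobt hfar henv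
    (hRT_of_quadraticResponse Φ L K c hM hT hcK hKR hc₀ hCK hnum) hQ

end Junction

/-! ## §5  A2/A6: the response letters and the numeral are jointly inhabited by a NONLINEAR response -/

/-- the witness response `Φ w = w + w²∕4` on `K = [−1, 1]` with linearisations `L_w = (1 + w∕2)·id` has quadratic
remainder EXACTLY `¼(w′ − w)²`. [textbook] -/
theorem witness_remainder (w w' : ℝ) :
    ‖(w' + w' ^ 2 / 4) - (w + w ^ 2 / 4) - ((1 + w / 2) • LinearMap.id (R := ℝ) (M := ℝ)) (w' - w)‖
      = 1 / 4 * ‖w' - w‖ ^ 2 := by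
  simp only [LinearMap.smul_apply, LinearMap.id_coe, id_eq, smul_eq_mul, Real.norm_eq_abs]
  rw [← abs_pow, show w' + w' ^ 2 / 4 - (w + w ^ 2 / 4) - (1 + w / 2) * (w' - w) = 1 / 4 * (w' - w) ^ 2 by ring,
    abs_mul, abs_of_pos (by norm_num : (0 : ℝ) < 1 / 4)]

/-- **A2/A6 — THE RESPONSE LETTERS OF §2–§4 ARE JOINTLY INHABITED BY A GENUINELY NONLINEAR RESPONSE**: `Φ w = w + w²∕4`
(not affine), `L_w = (1 + w∕2)·id`, `K = [−1, 1]`, centre `c = 0 ∈ K`, `M = ¼`, `R = 1`, `c₀ = 0`, and the numeral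
`c₀ + 4MR² ≤ (1 − κ₀)θ(1−ρ)` at `θ = 4`, `ρ = κ₀ = ½`. [textbook] -/
theorem quadraticResponse_letters_inhabited :
    ∃ (Φ : ℝ → ℝ) (L : ℝ → ℝ →ₗ[ℝ] ℝ) (K : Set ℝ) (c M R c₀ θ ρ κ₀ : ℝ),
      (¬ ∃ a b : ℝ, ∀ w, Φ w = a * w + b) ∧ 0 ≤ M ∧
      (∀ w ∈ K, ∀ w' ∈ K, ‖Φ w' - Φ w - L w (w' - w)‖ ≤ M * ‖w' - w‖ ^ 2) ∧
      c ∈ K ∧ (∀ w ∈ K, ‖w - c‖ ≤ R) ∧ ‖Φ c‖ ≤ c₀ ∧ 0 < θ ∧ 0 < ρ ∧ ρ < 1 ∧ 0 < κ₀ ∧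
      c₀ + 4 * M * R ^ 2 ≤ (1 - κ₀) * (θ * (1 - ρ)) := by
  refine ⟨fun w => w + w ^ 2 / 4, fun w => (1 + w / 2) • LinearMap.id, Icc (-1) 1, 0, 1 / 4, 1, 0, 4, 1 / 2, 1 / 2,
    ?_, by norm_num, ?_, ?_, ?_, ?_, by norm_num, by norm_num, by norm_num, by norm_num, by norm_num⟩
  · rintro ⟨a, b, h⟩
    have h0 := h 0
    have h2 := h 2
    have h4 := h (-2)
    norm_num at h0 h2 h4
    linarith
  · intro w _ w' _
    exact (witness_remainder w w').le
  · exact ⟨by norm_num, by norm_num⟩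
  · intro w hw
    rw [sub_zero, Real.norm_eq_abs, abs_le]
    exact hw
  · norm_num

/-- **… AND §3 APPLIES TO THE WITNESS** (frame `X = Unit`, `V = E = ℝ`, one plaquette `P = Unit`, cut
`C = {p | p.2 ∈ [−1, 1]}`): the discharged `hRT` holds for `U p = ⨆ _, ‖p.2 + p.2²∕4‖` with rate `κ₀ = ½` at `θ = 4`,
`ρ = ½`.  CAVEAT (v1.1, ref-O READ-1 NIT-2): on this cut `U ≤ 5∕4 < 2 = θ(1−ρ)`, so the shell is EMPTY and this
implication is VACUOUS — it certifies only that the letters type-check against §3; the non-vacuous witness is the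
companion file's `N21ResponseRadialTransversalitySanity.hRT_of_quadraticResponse_apply_witness_slope3` ∕
`apply_witness_slope3_antecedent_inhabited`. [textbook] -/
theorem hRT_of_quadraticResponse_apply_witness :
    ∀ p : Unit × ℝ, 4 * (1 - 1 / 2) ≤ (⨆ _ : Unit, ‖p.2 + p.2 ^ 2 / 4‖) → (⨆ _ : Unit, ‖p.2 + p.2 ^ 2 / 4‖) < 4 →
      p ∈ {p : Unit × ℝ | p.2 ∈ Icc (-1 : ℝ) 1} → ∀ s : ℝ, 1 ≤ s →
      4 * (1 - 1 / 2) ≤ (⨆ _ : Unit, ‖(0 + s • (p.2 - 0)) + (0 + s • (p.2 - 0)) ^ 2 / 4‖) →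
        (⨆ _ : Unit, ‖(0 + s • (p.2 - 0)) + (0 + s • (p.2 - 0)) ^ 2 / 4‖) < 4 →
          (p.1, (0 : ℝ) + s • (p.2 - 0)) ∈ {p : Unit × ℝ | p.2 ∈ Icc (-1 : ℝ) 1} →
          (⨆ _ : Unit, ‖p.2 + p.2 ^ 2 / 4‖) + 1 / 2 * (4 * (1 - 1 / 2)) * (s - 1)
            ≤ ⨆ _ : Unit, ‖(0 + s • (p.2 - 0)) + (0 + s • (p.2 - 0)) ^ 2 / 4‖ :=
  hRT_of_quadraticResponse (X := Unit) (V := ℝ) (E := ℝ) (P := Unit)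
    (fun _ _ w => w + w ^ 2 / 4) (fun _ _ w => (1 + w / 2) • LinearMap.id) (fun _ => Icc (-1) 1) (fun _ => 0)
    (M := 1 / 4) (R := 1) (c₀ := 0) (θ := 4) (ρ := 1 / 2) (κ₀ := 1 / 2) (by norm_num)
    (fun _ _ w _ w' _ => (witness_remainder w w').le) (fun _ => ⟨by norm_num, by norm_num⟩)
    (fun _ w hw => by rw [sub_zero, Real.norm_eq_abs, abs_le]; exact hw) (fun _ _ => by norm_num)
    (fun p hp => hp) (by norm_num)

end Summit.QuantumFields.YangMills.Theorems.N21ResponseRadialTransversality
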